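import Summits.CriticalPhenomena.PercolationContinuityZ3.Theorems.PercNearOneGluingNearOneGluingS2OfS2M

/-!
# Crux `PercNearOneGluing.NearOneGluing` (stmt-CriticalPhenomena-4574), line `SketchR2I5` —
# the exchange slack S1 from the conditional exchange inequality cEXCH

Lead prover-line-stmt-CriticalPhenomena-4574-c7 (cycle 7, wave 3).  Lands `--supports stmt-CriticalPhenomena-4574`;
no definitions, no named facts.

## Content

Finite weighted graph on `Fin n`, `μ = prodBernoulli w`, `{u ↔ v} = openConn u v`.  Notation:
`D := {y ↮ z}`, `D″ := {y ↮ x} ∩ {y ↮ z}`, `D_a := {x ↮ y} ∩ {x ↮ z}`, `W := D_a ∩ {o ↔ x}`,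
`N := {x ↮ y} ∩ {x ↮ z} ∩ {y ↮ z}`, `O := {o ↔ x} ∪ {o ↔ y}`, and for an event `Q`
`σ₁(Q) := μ(D)·μ(Q ∩ {y ↔ b} ∩ D) − μ(Q ∩ D)·μ({y ↔ b} ∩ D)` (`= μ(D)²·Cov(1_Q, 1{y↔b} | D)`).

The registered open stub `stub_exchS1` reads `μ(W)·σ₁({x↔y}) ≤ μ(D_a)·σ₁({o↔y})`
(`Cov_D(1{o↔y},1{y↔b}) ≥ θ·Cov_D(1{x↔y},1{y↔b})`, `θ = P(o↔x | x↮y, x↮z)`).  The wave-1 analysis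
(worker report ExchS1.md, crux NOTES §H) isolated the sharp residual **cEXCH** (registered as `stub_cexchS1`,
0 violations in 68 000 exact instances and for general increasing functions of `C_y`):
`Cov_D(1{o↔y},1{y↔b}) ≥ θ̂·Cov_D(1{x↔y},1{y↔b})` with `θ̂ := P(O | N) − P(o↔y | D″)`, in the
denominator-free form `(μ(O∩N)μ(D″) − μ({o↔y}∩D″)μ(N))·σ₁({x↔y}) ≤ μ(N)μ(D″)·σ₁({o↔y})`.
This file proves the REDUCTION

  `cEXCH ⟹ stub_exchS1`   (`exchS1_of_cexch`, registered-signature form `stub_exchS1OfCexch`),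

from tree facts only: `θ ≤ θ_M := P(o↔x | N)` and `P(o↔y | D″) ≤ P(o↔y | N)` (two instances of the
conditional-disconnection tilt `condDisconnTilt`, lead c7 wave 2, p169095; `s2red_theta_le_thetaM` from the S2 reduction file p169254), whence `θ ≤ θ_M ≤ θ̂` because
`O ∩ N = ({o↔x} ∩ N) ⊔ ({o↔y} ∩ N)`; `σ₁({x↔y}) ≥ 0` (van den Berg–Häggström–Kahn Thm. 1.3,
`knLemma3i_oneCluster`); and Harris for the decreasing events `D_a`, `D` (`μ(N) ≥ μ(D_a)μ(D)`) for the
degenerate case `μ(N) = 0`.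
[cite: VandenbergHaggstromKahn2005, Thm. 1.3 (p. 6)] [cite: KozmaNitzan2024, Question 7 (p. 36), Lemma 2 (p. 6)]
-/

namespace Summit.CriticalPhenomena.PercolationContinuityZ3.Theorems

open MeasureTheory Set Literature.Probability.LatticeModels Literature.Probability.Percolation
open scoped Classical
open Q7ThreeCut

noncomputable section

variable {n : ℕ}

/-- **P(o↔y | D″) ≤ P(o↔y | N)**: `μ({o↔y} ∩ D″)·μ(N) ≤ μ({o↔y} ∩ N)·μ(D″)` (tilt with source `y`,
avoided `{x,z}`, target `o`, disconnection `{x ↮ z}`). [folklore] -/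
theorem s1red_oy_tilt (w : Sym2 (Fin n) → unitInterval) (o x y z : Fin n) :
    (prodBernoulli w).real (openConn o y ∩ ((openConn y x)ᶜ ∩ (openConn y z)ᶜ)) *
        (prodBernoulli w).real ((openConn x y)ᶜ ∩ (openConn x z)ᶜ ∩ (openConn y z)ᶜ) ≤
      (prodBernoulli w).real (openConn o y ∩ ((openConn x y)ᶜ ∩ (openConn x z)ᶜ ∩ (openConn y z)ᶜ)) *
        (prodBernoulli w).real ((openConn y x)ᶜ ∩ (openConn y z)ᶜ) := by
  have h := condDisconnTilt w ({x, z} : Finset (Fin n)) y o x z (by simp)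
  rw [s2red_avoid_pair_eq y x z, knThm2_openConn_comm y o] at h
  -- `R ∩ {x↮z} = N` and `R ∩ {y↔o} ∩ {x↮z} = {o↔y} ∩ N` with `R = {y↮x} ∩ {y↮z}`
  have e1 : ((openConn y x)ᶜ ∩ (openConn y z)ᶜ ∩ (openConn x z)ᶜ : Set (BondConfig (Fin n))) =
      (openConn x y)ᶜ ∩ (openConn x z)ᶜ ∩ (openConn y z)ᶜ := by
    rw [knThm2_openConn_comm y x]; ext ω; simp only [mem_inter_iff, mem_compl_iff]; tauto
  have e2 : ((openConn y x)ᶜ ∩ (openConn y z)ᶜ ∩ openConn o y ∩ (openConn x z)ᶜ : Set (BondConfig (Fin n))) =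
      openConn o y ∩ ((openConn x y)ᶜ ∩ (openConn x z)ᶜ ∩ (openConn y z)ᶜ) := by
    rw [knThm2_openConn_comm y x]; ext ω; simp only [mem_inter_iff, mem_compl_iff]; tauto
  have e3 : ((openConn y x)ᶜ ∩ (openConn y z)ᶜ ∩ openConn o y : Set (BondConfig (Fin n))) =
      openConn o y ∩ ((openConn y x)ᶜ ∩ (openConn y z)ᶜ) := inter_comm _ _
  rw [e1, e2, e3] at h
  exact h

/-- **σ₁({x↔y}) ≥ 0**: `μ({x↔y} ∩ D)·μ({y↔b} ∩ D) ≤ μ(D)·μ({x↔y} ∩ {y↔b} ∩ D)`, `D = {y ↮ z}` — conditional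
positive association of the cluster of `y` given `y ↮ z` (BHK Thm. 1.3, `knLemma3i_oneCluster` with `f = 1{y↔b}`,
`Q = {y↔x}`). [cite: VandenbergHaggstromKahn2005, Thm. 1.3 (p. 6)] -/
theorem s1red_sigma_nonneg (w : Sym2 (Fin n) → unitInterval) (b x y z : Fin n) (hyz : y ≠ z) :
    (prodBernoulli w).real (openConn x y ∩ (openConn y z)ᶜ) *
        (prodBernoulli w).real (openConn y b ∩ (openConn y z)ᶜ) ≤
      (prodBernoulli w).real (openConn y z)ᶜ *
        (prodBernoulli w).real (openConn x y ∩ openConn y b ∩ (openConn y z)ᶜ) := by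
  have bhk := knLemma3i_oneCluster w y z b (openConn y x) (pivDom_openConn_mono_openEdgeCluster y x) hyz
  rw [← knThm2_openConn_comm x y] at bhk
  have e1 : ((openConn y z)ᶜ ∩ openConn y b : Set (BondConfig (Fin n))) = openConn y b ∩ (openConn y z)ᶜ :=
    inter_comm _ _
  have e2 : ((openConn y z)ᶜ ∩ openConn x y : Set (BondConfig (Fin n))) = openConn x y ∩ (openConn y z)ᶜ :=
    inter_comm _ _
  have e3 : ((openConn y z)ᶜ ∩ (openConn y b ∩ openConn x y) : Set (BondConfig (Fin n))) =
      openConn x y ∩ openConn y b ∩ (openConn y z)ᶜ := by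
    ext ω; simp only [mem_inter_iff, mem_compl_iff]; tauto
  rw [e1, e2, e3] at bhk
  linarith

/-- On `N` the events `{o↔x}`, `{o↔y}` are disjoint, so `μ(O ∩ N) = μ({o↔x} ∩ N) + μ({o↔y} ∩ N)`. [folklore] -/
theorem s1red_real_O_inter_N (w : Sym2 (Fin n) → unitInterval) (o x y z : Fin n) :
    (prodBernoulli w).real ((openConn o x ∪ openConn o y) ∩ ((openConn x y)ᶜ ∩ (openConn x z)ᶜ ∩ (openConn y z)ᶜ)) =
      (prodBernoulli w).real (openConn o x ∩ ((openConn x y)ᶜ ∩ (openConn x z)ᶜ ∩ (openConn y z)ᶜ)) +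
        (prodBernoulli w).real (openConn o y ∩ ((openConn x y)ᶜ ∩ (openConn x z)ᶜ ∩ (openConn y z)ᶜ)) := by
  rw [union_inter_distrib_right]
  refine measureReal_union ?_ MeasurableSet.of_discrete
  rw [disjoint_left]
  rintro ω ⟨hox, ⟨⟨hxy, -⟩, -⟩⟩ ⟨hoy, -⟩
  exact hxy (conn_trans (conn_symm hox) hoy)

set_option maxHeartbeats 400000 in
/-- **S1 from cEXCH.**  If `(μ(O∩N)μ(D″) − μ({o↔y}∩D″)μ(N))·σ₁({x↔y}) ≤ μ(N)μ(D″)·σ₁({o↔y})` (the conditional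
exchange inequality cEXCH, registered `stub_cexchS1`) then `μ(W)·σ₁({x↔y}) ≤ μ(D_a)·σ₁({o↔y})` (the registered
`stub_exchS1`).  Proof: multiply the goal by `μ(N)μ(D″)`; the cEXCH coefficient times `μ(D_a)` is at least
`μ(W)μ(N)μ(D″)` by the two tilts and the disjoint decomposition of `O ∩ N`, and `σ₁({x↔y}) ≥ 0`; the
degenerate case `μ(N)μ(D″) = 0` forces `μ(D_a)μ(D) = 0` (Harris; `N ⊆ D″`), where both sides vanish.
[cite: KozmaNitzan2024, Question 7 (p. 36)] -/
theorem exchS1_of_cexch (w : Sym2 (Fin n) → unitInterval) (o b x y z : Fin n) (hyz : y ≠ z)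
    (hC : ((prodBernoulli w).real ((openConn o x ∪ openConn o y) ∩ ((openConn x y)ᶜ ∩ (openConn x z)ᶜ ∩ (openConn y z)ᶜ)) *
            (prodBernoulli w).real ((openConn y x)ᶜ ∩ (openConn y z)ᶜ) -
          (prodBernoulli w).real (openConn o y ∩ ((openConn y x)ᶜ ∩ (openConn y z)ᶜ)) *
            (prodBernoulli w).real ((openConn x y)ᶜ ∩ (openConn x z)ᶜ ∩ (openConn y z)ᶜ)) *
        ((prodBernoulli w).real (openConn y z)ᶜ *
            (prodBernoulli w).real (openConn x y ∩ openConn y b ∩ (openConn y z)ᶜ) -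
          (prodBernoulli w).real (openConn x y ∩ (openConn y z)ᶜ) *
            (prodBernoulli w).real (openConn y b ∩ (openConn y z)ᶜ)) ≤
      ((prodBernoulli w).real ((openConn x y)ᶜ ∩ (openConn x z)ᶜ ∩ (openConn y z)ᶜ) *
          (prodBernoulli w).real ((openConn y x)ᶜ ∩ (openConn y z)ᶜ)) *
        ((prodBernoulli w).real (openConn y z)ᶜ *
            (prodBernoulli w).real (openConn o y ∩ openConn y b ∩ (openConn y z)ᶜ) -
          (prodBernoulli w).real (openConn o y ∩ (openConn y z)ᶜ) *
            (prodBernoulli w).real (openConn y b ∩ (openConn y z)ᶜ))) :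
    (prodBernoulli w).real (((openConn x y)ᶜ ∩ (openConn x z)ᶜ) ∩ openConn o x) *
        ((prodBernoulli w).real (openConn y z)ᶜ *
            (prodBernoulli w).real (openConn x y ∩ openConn y b ∩ (openConn y z)ᶜ) -
          (prodBernoulli w).real (openConn x y ∩ (openConn y z)ᶜ) *
            (prodBernoulli w).real (openConn y b ∩ (openConn y z)ᶜ)) ≤
      (prodBernoulli w).real ((openConn x y)ᶜ ∩ (openConn x z)ᶜ) *
        ((prodBernoulli w).real (openConn y z)ᶜ *
            (prodBernoulli w).real (openConn o y ∩ openConn y b ∩ (openConn y z)ᶜ) -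
          (prodBernoulli w).real (openConn o y ∩ (openConn y z)ᶜ) *
            (prodBernoulli w).real (openConn y b ∩ (openConn y z)ᶜ)) := by
  set μ := prodBernoulli w with hμ
  -- abbreviations
  set A := μ.real (((openConn x y)ᶜ ∩ (openConn x z)ᶜ) ∩ openConn o x : Set (BondConfig (Fin n))) with hA
  set Da := μ.real ((openConn x y)ᶜ ∩ (openConn x z)ᶜ : Set (BondConfig (Fin n))) with hDa
  set Nn := μ.real ((openConn x y)ᶜ ∩ (openConn x z)ᶜ ∩ (openConn y z)ᶜ : Set (BondConfig (Fin n))) with hNn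
  set Dpp := μ.real ((openConn y x)ᶜ ∩ (openConn y z)ᶜ : Set (BondConfig (Fin n))) with hDpp
  set oxN := μ.real (openConn o x ∩ ((openConn x y)ᶜ ∩ (openConn x z)ᶜ ∩ (openConn y z)ᶜ) : Set (BondConfig (Fin n)))
    with hoxN
  set oyN := μ.real (openConn o y ∩ ((openConn x y)ᶜ ∩ (openConn x z)ᶜ ∩ (openConn y z)ᶜ) : Set (BondConfig (Fin n)))
    with hoyN
  set ON := μ.real ((openConn o x ∪ openConn o y) ∩ ((openConn x y)ᶜ ∩ (openConn x z)ᶜ ∩ (openConn y z)ᶜ) :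
    Set (BondConfig (Fin n))) with hON
  set oyDpp := μ.real (openConn o y ∩ ((openConn y x)ᶜ ∩ (openConn y z)ᶜ) : Set (BondConfig (Fin n))) with hoyDpp
  set d := μ.real ((openConn y z)ᶜ : Set (BondConfig (Fin n))) with hd
  set qx := μ.real (openConn x y ∩ (openConn y z)ᶜ : Set (BondConfig (Fin n))) with hqx
  set qxb := μ.real (openConn x y ∩ openConn y b ∩ (openConn y z)ᶜ : Set (BondConfig (Fin n))) with hqxb
  set qo := μ.real (openConn o y ∩ (openConn y z)ᶜ : Set (BondConfig (Fin n))) with hqo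
  set qob := μ.real (openConn o y ∩ openConn y b ∩ (openConn y z)ᶜ : Set (BondConfig (Fin n))) with hqob
  set yb := μ.real (openConn y b ∩ (openConn y z)ᶜ : Set (BondConfig (Fin n))) with hyb
  -- the inputs
  have htilt1 : A * Nn ≤ oxN * Da := s2red_theta_le_thetaM w o x y z
  have htilt2 : oyDpp * Nn ≤ oyN * Dpp := s1red_oy_tilt w o x y z
  have hsig : qx * yb ≤ d * qxb := s1red_sigma_nonneg w b x y z hyz
  have hhar : Da * d ≤ Nn := s2red_harris_N w x y z
  have hON : ON = oxN + oyN := s1red_real_O_inter_N w o x y z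
  -- nonnegativity / monotonicity facts
  have hA_le : A ≤ Da := by rw [hA, hDa]; exact measureReal_mono inter_subset_left
  have hA0 : 0 ≤ A := measureReal_nonneg
  have hDa0 : 0 ≤ Da := measureReal_nonneg
  have hN0 : 0 ≤ Nn := measureReal_nonneg
  have hDpp0 : 0 ≤ Dpp := measureReal_nonneg
  have hox0 : 0 ≤ oxN := measureReal_nonneg
  have hoy0 : 0 ≤ oyN := measureReal_nonneg
  have hoyDpp0 : 0 ≤ oyDpp := measureReal_nonneg
  have hd0 : 0 ≤ d := measureReal_nonneg
  have hN_le_Dpp : Nn ≤ Dpp := by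
    rw [hNn, hDpp, knThm2_openConn_comm y x]
    refine measureReal_mono ?_
    intro ω hω
    exact ⟨hω.1.1, hω.2⟩
  have hqx_le : qx ≤ d := by rw [hqx, hd]; exact measureReal_mono inter_subset_right
  have hqo_le : qo ≤ d := by rw [hqo, hd]; exact measureReal_mono inter_subset_right
  have hqxb_le : qxb ≤ d := by rw [hqxb, hd]; exact measureReal_mono inter_subset_right
  have hqob_le : qob ≤ d := by rw [hqob, hd]; exact measureReal_mono inter_subset_right
  have hyb_le : yb ≤ d := by rw [hyb, hd]; exact measureReal_mono inter_subset_right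
  have hqx0 : 0 ≤ qx := measureReal_nonneg
  have hqo0 : 0 ≤ qo := measureReal_nonneg
  have hqxb0 : 0 ≤ qxb := measureReal_nonneg
  have hqob0 : 0 ≤ qob := measureReal_nonneg
  have hyb0 : 0 ≤ yb := measureReal_nonneg
  -- cEXCH in the abbreviations
  have hC' : (ON * Dpp - oyDpp * Nn) * (d * qxb - qx * yb) ≤ (Nn * Dpp) * (d * qob - qo * yb) := hC
  -- coefficient comparison: Da * (ON*Dpp − oyDpp*Nn) ≥ A * Nn * Dpp
  have hcoef : A * (Nn * Dpp) ≤ Da * (ON * Dpp - oyDpp * Nn) := by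
    rw [hON]
    nlinarith [mul_le_mul_of_nonneg_right htilt1 hDpp0, mul_le_mul_of_nonneg_left htilt2 hDa0]
  -- main inequality multiplied by μ(N)μ(D″)
  have hsig' : 0 ≤ d * qxb - qx * yb := by linarith
  have key : (Nn * Dpp) * (A * (d * qxb - qx * yb)) ≤ (Nn * Dpp) * (Da * (d * qob - qo * yb)) := by
    nlinarith [mul_le_mul_of_nonneg_right hcoef hsig', mul_le_mul_of_nonneg_left hC' hDa0]
  by_cases hND : Nn * Dpp = 0
  · -- degenerate: μ(N) = 0 (since N ⊆ D″, μ(D″) = 0 forces μ(N) = 0), hence μ(D_a)μ(D) = 0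
    have hN_z : Nn = 0 := by
      rcases mul_eq_zero.1 hND with h | h
      · exact h
      · exact le_antisymm (by simpa [h] using hN_le_Dpp) hN0
    have hprod : Da * d = 0 := le_antisymm (by simpa [hN_z] using hhar) (mul_nonneg hDa0 hd0)
    rcases mul_eq_zero.1 hprod with hDa_z | hd_z
    · have hA_z : A = 0 := le_antisymm (by simpa [hDa_z] using hA_le) hA0
      rw [hA_z, hDa_z]; simp
    · have hqx_z : qx = 0 := le_antisymm (by simpa [hd_z] using hqx_le) hqx0
      have hqo_z : qo = 0 := le_antisymm (by simpa [hd_z] using hqo_le) hqo0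
      have hqxb_z : qxb = 0 := le_antisymm (by simpa [hd_z] using hqxb_le) hqxb0
      have hqob_z : qob = 0 := le_antisymm (by simpa [hd_z] using hqob_le) hqob0
      rw [hd_z, hqx_z, hqo_z, hqxb_z, hqob_z]; simp
  · have hpos : 0 < Nn * Dpp := lt_of_le_of_ne (mul_nonneg hN0 hDpp0) (Ne.symm hND)
    exact le_of_mul_le_mul_left key hpos

/-- **Quantified reduction** (the registered `stub_cexchS1` signature implies the registered `stub_exchS1` signature): for every graph and all `o b x y z` with `x, y, z`
distinct, the conditional exchange inequality cEXCH implies the exchange slack inequality S1 (pointwise form of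
`exchS1_of_cexch`). [cite: KozmaNitzan2024, Question 7 (p. 36)] -/
theorem exchS1_of_cexch_forall : ∀ (n : ℕ) (w : Sym2 (Fin n) → unitInterval) (o b x y z : Fin n), x ≠ y → x ≠ z → y ≠ z → (((Literature.Probability.LatticeModels.prodBernoulli w).real ((Literature.Probability.Percolation.openConn o x ∪ Literature.Probability.Percolation.openConn o y) ∩ ((Literature.Probability.Percolation.openConn x y)ᶜ ∩ (Literature.Probability.Percolation.openConn x z)ᶜ ∩ (Literature.Probability.Percolation.openConn y z)ᶜ)) * (Literature.Probability.LatticeModels.prodBernoulli w).real ((Literature.Probability.Percolation.openConn y x)ᶜ ∩ (Literature.Probability.Percolation.openConn y z)ᶜ) - (Literature.Probability.LatticeModels.prodBernoulli w).real (Literature.Probability.Percolation.openConn o y ∩ ((Literature.Probability.Percolation.openConn y x)ᶜ ∩ (Literature.Probability.Percolation.openConn y z)ᶜ)) * (Literature.Probability.LatticeModels.prodBernoulli w).real ((Literature.Probability.Percolation.openConn x y)ᶜ ∩ (Literature.Probability.Percolation.openConn x z)ᶜ ∩ (Literature.Probability.Percolation.openConn y z)ᶜ)) * ((Literature.Probability.LatticeModels.prodBernoulli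 w).real (Literature.Probability.Percolation.openConn y z)ᶜ * (Literature.Probability.LatticeModels.prodBernoulli w).real (Literature.Probability.Percolation.openConn x y ∩ Literature.Probability.Percolation.openConn y b ∩ (Literature.Probability.Percolation.openConn y z)ᶜ) - (Literature.Probability.LatticeModels.prodBernoulli w).real (Literature.Probability.Percolation.openConn x y ∩ (Literature.Probability.Percolation.openConn y z)ᶜ) * (Literature.Probability.LatticeModels.prodBernoulli w).real (Literature.Probability.Percolation.openConn y b ∩ (Literature.Probability.Percolation.openConn y z)ᶜ)) ≤ ((Literature.Probability.LatticeModels.prodBernoulli w).real ((Literature.Probability.Percolation.openConn x y)ᶜ ∩ (Literature.Probability.Percolation.openConn x z)ᶜ ∩ (Literature.Probability.Percolation.openConn y z)ᶜ) * (Literature.Probability.LatticeModels.prodBernoulli w).real ((Literature.Probability.Percolation.openConn y x)ᶜ ∩ (Literature.Probability.Percolation.openConn y z)ᶜ)) * ((Literature.Probability.LatticeModels.prodBernoulli w).real (Literature.Probability.Percolation.openConn y z)ᶜ * (Literature.Probability.LatticeModels.prodBernoulli w).real (Literature.Probability.Percolation.openConn o y ∩ Literature.Probability.Percolation.openConn y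 b ∩ (Literature.Probability.Percolation.openConn y z)ᶜ) - (Literature.Probability.LatticeModels.prodBernoulli w).real (Literature.Probability.Percolation.openConn o y ∩ (Literature.Probability.Percolation.openConn y z)ᶜ) * (Literature.Probability.LatticeModels.prodBernoulli w).real (Literature.Probability.Percolation.openConn y b ∩ (Literature.Probability.Percolation.openConn y z)ᶜ))) → (Literature.Probability.LatticeModels.prodBernoulli w).real (((Literature.Probability.Percolation.openConn x y)ᶜ ∩ (Literature.Probability.Percolation.openConn x z)ᶜ) ∩ Literature.Probability.Percolation.openConn o x) * ((Literature.Probability.LatticeModels.prodBernoulli w).real (Literature.Probability.Percolation.openConn y z)ᶜ * (Literature.Probability.LatticeModels.prodBernoulli w).real (Literature.Probability.Percolation.openConn x y ∩ Literature.Probability.Percolation.openConn y b ∩ (Literature.Probability.Percolation.openConn y z)ᶜ) - (Literature.Probability.LatticeModels.prodBernoulli w).real (Literature.Probability.Percolation.openConn x y ∩ (Literature.Probability.Percolation.openConn y z)ᶜ) * (Literature.Probability.LatticeModels.prodBernoulli w).real (Literature.Probability.Percolation.openConn y b ∩ (Literature.Probability.Percolation.openConn y z)ᶜ)) ≤ (Literature.Probability.LatticeModels.prodBernoulli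 w).real ((Literature.Probability.Percolation.openConn x y)ᶜ ∩ (Literature.Probability.Percolation.openConn x z)ᶜ) * ((Literature.Probability.LatticeModels.prodBernoulli w).real (Literature.Probability.Percolation.openConn y z)ᶜ * (Literature.Probability.LatticeModels.prodBernoulli w).real (Literature.Probability.Percolation.openConn o y ∩ Literature.Probability.Percolation.openConn y b ∩ (Literature.Probability.Percolation.openConn y z)ᶜ) - (Literature.Probability.LatticeModels.prodBernoulli w).real (Literature.Probability.Percolation.openConn o y ∩ (Literature.Probability.Percolation.openConn y z)ᶜ) * (Literature.Probability.LatticeModels.prodBernoulli w).real (Literature.Probability.Percolation.openConn y b ∩ (Literature.Probability.Percolation.openConn y z)ᶜ)) :=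
  fun _ w o b x y z _ _ hyz hC => exchS1_of_cexch w o b x y z hyz hC

/-- **Registered helper stub** `stub_oyTiltN`: `μ({o↔y} ∩ D″)·μ(N) ≤ μ({o↔y} ∩ N)·μ(D″)`, i.e.
`P(o ↔ y | y↮x, y↮z) ≤ P(o ↔ y | x, y, z pairwise separated)` (= `s1red_oy_tilt`). [folklore] -/
theorem stub_oyTiltN : ∀ (n : ℕ) (w : Sym2 (Fin n) → unitInterval) (o x y z : Fin n), (Literature.Probability.LatticeModels.prodBernoulli w).real (Literature.Probability.Percolation.openConn o y ∩ ((Literature.Probability.Percolation.openConn y x)ᶜ ∩ (Literature.Probability.Percolation.openConn y z)ᶜ)) * (Literature.Probability.LatticeModels.prodBernoulli w).real ((Literature.Probability.Percolation.openConn x y)ᶜ ∩ (Literature.Probability.Percolation.openConn x z)ᶜ ∩ (Literature.Probability.Percolation.openConn y z)ᶜ) ≤ (Literature.Probability.LatticeModels.prodBernoulli w).real (Literature.Probability.Percolation.openConn o y ∩ ((Literature.Probability.Percolation.openConn x y)ᶜ ∩ (Literature.Probability.Percolation.openConn x z)ᶜ ∩ (Literature.Probability.Percolation.openConn y z)ᶜ))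 * (Literature.Probability.LatticeModels.prodBernoulli w).real ((Literature.Probability.Percolation.openConn y x)ᶜ ∩ (Literature.Probability.Percolation.openConn y z)ᶜ) :=
  fun _ w o x y z => s1red_oy_tilt w o x y z

end

end Summit.CriticalPhenomena.PercolationContinuityZ3.Theorems
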